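import Summits.BirchSwinnertonDyer.BirchSwinnertonDyer.Theses.DerivedKatoValuationDoor
import Summits.BirchSwinnertonDyer.BirchSwinnertonDyer.Theorems.DerivedKatoValuationDoorDerivedKatoDoorStubAdmissibleNeZero
import Literature.NumberTheory.EllipticCurves.Kato2004.GeneratorChange
import Literature.NumberTheory.EllipticCurves.Kato2004.IwasawaCohomologyUniqueProofs
import Literature.NumberTheory.EllipticCurves.Kato2004.IwasawaH1RankLowerBoundProofs
import Literature.NumberTheory.EllipticCurves.Kato2004.IwasawaH1LambdaTorsionFreeProofs
import Literature.NumberTheory.EllipticCurves.Kato2004.IwasawaH1ProjZeroKernelProofs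
import Literature.NumberTheory.EllipticCurves.Kato2004.DivisibilityInputs
import Literature.NumberTheory.EllipticCurves.KatoRankBoundProofs
import Literature.NumberTheory.EllipticCurves.ZpExtensionUnitTwistProofs
import Literature.NumberTheory.EllipticCurves.BSDSelmerPConverseRationalHeegnerDescentProofs
import Literature.NumberTheory.EllipticCurves.PAdicLFunctionNeZeroHoldsProofs
import Literature.NumberTheory.EllipticCurves.IwasawaSelmerDualProofs
import Literature.NumberTheory.EllipticCurves.Kato2004.EulerSystemClassNonvanishingRohrlichProofs
import Literature.NumberTheory.EllipticCurves.NonEisensteinPrimeOfSurjective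
import HarnessLib

/-!
# Route `DerivedKatoValuationDoor`, crux `FineLengthLeOneOfAnalyticRankTwo` (stmt-BirchSwinnertonDyer-23259),
# line `descent` (revision 2, skeleton `Cruxes/FineLengthLeOneOfAnalyticRankTwo/Lines/descent.lean`):
# the print stub F2 `stub_oneLeRankIwasawaH1` (`Kato2004.one_le_rank_iwasawaH1`, Kato (12.2.2)) AT DOOR
# PRIMES costs the route NOTHING NEW — it follows from the route's OWN support item
# `AdmissibleZetaClassExists` (stmt-BirchSwinnertonDyer-23029, a binder of `closes`), and equally from any
# §17.13 package (`Kato2004.DivisibilityInputs`, which the sibling item 23260's clause `hX` posits)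

Stub worker `bsd-line-dkd-w2` (g1); `--supports stmt-BirchSwinnertonDyer-23259`; namespace
`…Theorems.DerivedKatoValuationDoor`. THEOREMS ONLY (no `def`, no new named fact, no `sorry`).

WHAT. The line `descent` reads `ℓ_T(X₀(E/ℚ_∞))` through Kato's descent sequence (14.14.1) and uses F2 only
as «`1 ≤ ℓ_T(𝐇¹/T𝐇¹)` for every cyclotomic pin `I : IwasawaH1Data W p κ γ` at a door prime»
(`Descent.one_le_lengthAtT_coinvariants_H`), i.e. only «`𝐇¹_Γ(T_pW) ≠ 0`» there. This file proves, sorry-free: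

* `nontrivial_iwasawaH1_of_nontrivial` — NON-TRIVIALITY IS INDEPENDENT OF THE PIN AND OF THE CYCLOTOMIC
  DATUM/GENERATOR: if one pinned `𝐇¹_Γ(T_pW)` over one cyclotomic `(K₁, γ₁)` is non-zero, then every
  pinned `𝐇¹_Γ(T_pW)` over every cyclotomic `(K, γ)` is (change of datum/generator
  `IwasawaH1Data.changeData` to the normalised pair — Washington §13.2, `T ↦ (1+T)^u − 1` — then the
  uniqueness of the pin `IwasawaH1Data.exists_linearEquiv`; both tree theorems).
* `nontrivial_iwasawaH1_of_admissibleZetaClassExists` — AT A DOOR PRIME (`5 ≤ p`, good ordinary,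
  `ρ̄_{E,p}` onto), the route item `AdmissibleZetaClassExists` (Kato Thm. 12.5 realisability: some pin
  over some cyclotomic datum carries an admissible zeta class) gives `Nontrivial I.H` for EVERY cyclotomic
  pin: an admissible class is `≠ 0` (landed `Theorems.stub_admissibleNeZero`, p657733: Kato Thm. 12.5 (1)
  via Rohrlich, all inputs tree theorems) and non-triviality transports.
* `one_le_rank_iwasawaH1_of_admissibleZetaClassExists`,
  `one_le_rank_iwasawaH1_at_door_of_admissibleZetaClassExists` — F2's statement
  `1 ≤ rank_Λ 𝐇¹_Γ(T_pW)` RESTRICTED TO DOOR PRIMES (the only place the line uses it), from the route item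
  (`𝐇¹` is torsion free: tree theorem `IwasawaH1Data.isTorsionFree`).
* `one_le_lengthAt_coinvariants_iwasawaH1_of_admissibleZetaClassExists` — EXACTLY the consumer shape of
  the line (`1 ≤ ℓ_T(𝐇¹/T𝐇¹)`), so the LEAD may reshape F2 ↦ the route item 23029 by name: the line's
  trust base then drops the extra named fact (12.2.2).
* `nontrivial_iwasawaH1_of_divisibilityInputs`, `nontrivial_iwasawaH1_of_exists_divisibilityInputs` — the
  same non-triviality from ANY §17.13 package `K : DivisibilityInputs W p f κ γ I D` (its zeta module
  `K.Z ≤ 𝐇¹` contains a class `z` with `col (loc z) = p^n·L_p(E,T) ≠ 0` by Rohrlich, tree theorem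
  `padicLFunction_unitRoot_ne_zero`), resp. from the named construction fact
  `Kato2004.exists_divisibilityInputs` for every cyclotomic pair — the package the sibling item 23260
  (`kato_mainConjecture_primeT_of_door`, clause `hX` of `MainConjecturePrimeTDoorOfInputs`) posits anyway.

HONEST FRAMING. Nothing here is unconditional beyond the transport lemma: the door-prime statements are
CONDITIONAL on the route item `AdmissibleZetaClassExists` (stmt-23029, open, print: Kato Thm. 12.5 (1)(4)
under (12.5.2)) resp. on a §17.13 package / `exists_divisibilityInputs` (named fact, no `_holds`) and a
newform of `W`. The named fact `one_le_rank_iwasawaH1` itself (EVERY prime `p`, no door) is NOT proved: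
away from door primes the tree has no non-zero norm-compatible family. The crux 23259, its parent 23024
and BSD are not advanced by this file; it only shows that F2 adds no hypothesis to the route beyond its
declared items. Disproof read: `Cruxes/DerivedKatoDoor/Disproof.lean` r2 (no `-- Targets` on F2).

References: K. Kato, Astérisque 295 (2004), §12.2 (12.2.1)–(12.2.2) (p. 220), Thm. 12.4 (2) (p. 221),
Thm. 12.5 (1) (pp. 221–222), Thm. 12.6 (p. 222), Thm. 16.6 (p. 271), §17.13 (pp. 279–280)
[Kato2004Asterisque]; L. C. Washington, *Introduction to Cyclotomic Fields*, GTM 83, §13.1–13.2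
[Washington1997]; D. Rohrlich, Invent. Math. 75 (1984), Theorem p. 409 [RohrlichInventiones1984].
-/

-- D-0017: single-problem summit, so `Summit.BirchSwinnertonDyer.BirchSwinnertonDyer.…` repeats a
-- namespace BY DESIGN.
set_option linter.dupNamespace false

noncomputable section

namespace Summit.BirchSwinnertonDyer.BirchSwinnertonDyer.Theorems.DerivedKatoValuationDoor

open Field CongruenceSubgroup
open Literature Literature.NumberTheory.GaloisRepresentations
open Literature.NumberTheory.EllipticCurves Literature.NumberTheory.EllipticCurves.IwasawaAlgebra
open Literature.NumberTheory.EllipticCurves.ModularForms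
open Literature.NumberTheory.EllipticCurves.Kato2004
open Literature.NumberTheory.EllipticCurves.Kato2004.EulerSystemValues

/-! ## §1 Non-triviality of `𝐇¹_Γ(T_pW)` does not depend on the pin, the cyclotomic datum or the generator -/

section Transport

variable {W : WeierstrassCurve ℚ} [W.IsElliptic] {p : ℕ} [Fact p.Prime]
  [ContinuousSMul ℤ_[p] (W.tateModule p)]

/-- **Transport of non-triviality.** If ONE pinned Iwasawa cohomology `I₁ : IwasawaH1Data W p K₁ γ₁` over a
cyclotomic `ℤ_p`-extension datum `K₁` with topological generator `γ₁` is a non-zero module, then so is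
EVERY pinned `I : IwasawaH1Data W p K γ` over every cyclotomic `K` with topological generator `γ`. Proof:
both data are unit twists `u • κ₀` of the normalised cyclotomic datum `(κ₀, γ₀)`
(`exists_isCyclotomic_isTopGenerator_isCyclotomicVariable_holds`, `IsCyclotomic.exists_eq_unitTwist_holds`);
the change of datum/generator `IwasawaH1Data.changeData` (Washington §13.2: `φ_u : T ↦ (1+T)^u − 1`)
keeps the underlying abelian group; and two pins over the same `(κ₀, γ₀)` are isomorphic
(`IwasawaH1Data.exists_linearEquiv`, Kato §12.2: both are `lim← H¹(ℤ_n[1/p], T_pW)`).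
[cite: Kato2004Asterisque, §12.2 (12.2.1) (p. 220) and §13.8 (p. 228)] [cite: Washington1997, §13.2] -/
theorem nontrivial_iwasawaH1_of_nontrivial {K₁ : ZpExtension ℚ p} (hK₁ : K₁.IsCyclotomic)
    {γ₁ : absoluteGaloisGroup ℚ} (hγ₁ : K₁.IsTopGenerator γ₁) (I₁ : IwasawaH1Data W p K₁ γ₁)
    [Nontrivial I₁.H] {K : ZpExtension ℚ p} (hK : K.IsCyclotomic) {γ : absoluteGaloisGroup ℚ}
    (hγ : K.IsTopGenerator γ) (I : IwasawaH1Data W p K γ) : Nontrivial I.H := by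
  -- the normalised pair `(κ₀, γ₀)`; both data are unit twists of `κ₀`
  obtain ⟨κ₀, hκ₀, γ₀, hγ₀, -⟩ := exists_isCyclotomic_isTopGenerator_isCyclotomicVariable_holds p
  obtain ⟨c₁, rfl⟩ := ZpExtension.IsCyclotomic.exists_eq_unitTwist_holds (κ := κ₀) hκ₀ hK₁
  obtain ⟨c, rfl⟩ := ZpExtension.IsCyclotomic.exists_eq_unitTwist_holds (κ := κ₀) hκ₀ hK
  -- transport both pins to `(κ₀, γ₀)` (same underlying groups) and compare them there
  haveI : Nontrivial (I₁.changeData κ₀ c₁ hγ₁ hγ₀).H := ‹Nontrivial I₁.H›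
  obtain ⟨e, -⟩ := (I₁.changeData κ₀ c₁ hγ₁ hγ₀).exists_linearEquiv (I.changeData κ₀ c hγ hγ₀) hγ₀
  exact (e.toEquiv.symm.nontrivial : Nontrivial (I.changeData κ₀ c hγ hγ₀).H)

end Transport

/-! ## §2 At a door prime: `𝐇¹_Γ(T_pW) ≠ 0`, `1 ≤ rank_Λ 𝐇¹`, `1 ≤ ℓ_T(𝐇¹/T𝐇¹)` from the route item
`AdmissibleZetaClassExists` (stmt-BirchSwinnertonDyer-23029) -/

section FromAdmissible

variable (W : WeierstrassCurve ℚ) [W.IsElliptic] [W.IsGloballyMinimal] (p : ℕ) [Fact p.Prime]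
  [ContinuousSMul ℤ_[p] (W.tateModule p)]

/-- **At a door prime every pinned `𝐇¹_Γ(T_pW)` over every cyclotomic datum is a NON-ZERO module**,
granted the route's support item `AdmissibleZetaClassExists` (Kato Thm. 12.5 realisability: at a door prime
some pin over some cyclotomic datum carries an admissible Kato zeta class). The admissible class is `≠ 0`
(`Theorems.stub_admissibleNeZero`, Kato Thm. 12.5 (1) via Rohrlich — landed, all inputs tree theorems),
and non-triviality transports to every pin (`nontrivial_iwasawaH1_of_nontrivial`). CONDITIONAL on the
route item only. [cite: Kato2004Asterisque, Thm. 12.5 (1) and its proof (pp. 221–222)]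
[cite: RohrlichInventiones1984, Theorem (p. 409)] -/
theorem nontrivial_iwasawaH1_of_admissibleZetaClassExists
    (hAdm : Summit.BirchSwinnertonDyer.BirchSwinnertonDyer.Theses.DerivedKatoValuationDoor.AdmissibleZetaClassExists)
    (hdoor : 5 ≤ p ∧ IsOrdinaryAt W p ∧ W.HasSurjectiveModNGaloisRep p)
    {K : ZpExtension ℚ p} (hK : K.IsCyclotomic) {γ : absoluteGaloisGroup ℚ} (hγ : K.IsTopGenerator γ)
    (I : IwasawaH1Data W p K γ) : Nontrivial I.H := by
  obtain ⟨K₁, hK₁, γ₁, I₁, z₀, hγ₁, hz⟩ := hAdm W p hdoor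
  have hne : z₀ ≠ 0 := stub_admissibleNeZero W p K₁ hK₁ γ₁ I₁ z₀ hγ₁ hz
  haveI : Nontrivial I₁.H := nontrivial_of_ne z₀ 0 hne
  exact nontrivial_iwasawaH1_of_nontrivial hK₁ hγ₁ I₁ hK hγ I

/-- **F2 at a door prime from the route item**: `1 ≤ rank_Λ 𝐇¹_Γ(T_pW)` for every cyclotomic pin at a
door prime, granted `AdmissibleZetaClassExists` — Kato (12.2.2)'s consequence, here obtained from a
non-zero element (`𝐇¹` is `Λ`-torsion free: tree theorem `IwasawaH1Data.isTorsionFree`, Thm. 12.4 (2)).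
CONDITIONAL on the route item only. [cite: Kato2004Asterisque, §12.2 (12.2.2) (p. 220) and Thm. 12.4 (2) (p. 221)] -/
theorem one_le_rank_iwasawaH1_of_admissibleZetaClassExists
    (hAdm : Summit.BirchSwinnertonDyer.BirchSwinnertonDyer.Theses.DerivedKatoValuationDoor.AdmissibleZetaClassExists)
    (hdoor : 5 ≤ p ∧ IsOrdinaryAt W p ∧ W.HasSurjectiveModNGaloisRep p)
    {K : ZpExtension ℚ p} (hK : K.IsCyclotomic) {γ : absoluteGaloisGroup ℚ} (hγ : K.IsTopGenerator γ)
    (I : IwasawaH1Data W p K γ) : 1 ≤ Module.rank (IwasawaAlgebra p) I.H := by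
  haveI := nontrivial_iwasawaH1_of_admissibleZetaClassExists W p hAdm hdoor hK hγ I
  exact one_le_rank_iwasawaH1_of_nontrivial hγ I

/-- **The consumer shape of line `descent`: `1 ≤ ℓ_T(𝐇¹/T𝐇¹)`** (the length at `𝔭_T = (T)` of the
`Γ`-coinvariants of the pinned `𝐇¹_Γ(T_pW)`) for every cyclotomic pin at a door prime, granted the route
item `AdmissibleZetaClassExists` — verbatim the conclusion of the skeleton's
`Descent.one_le_lengthAtT_coinvariants_H`, with its input `one_le_rank_iwasawaH1` REPLACED by the route's own
support item: `𝐇¹` is finitely generated (`IwasawaH1Data.module_finite_of_isCyclotomic`, (12.2.1)), torsion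
free (`IwasawaH1Data.isTorsionFree`) and non-zero (above), and a non-zero finitely generated torsion-free
`Λ`-module has `ℓ_T` of its coinvariants `≥ 1` (`one_le_lengthAt_coinvariants_of_isTorsionFree`).
CONDITIONAL on the route item only.
[cite: Kato2004Asterisque, §12.2 (12.2.1)–(12.2.2) (p. 220), Thm. 12.4 (2) (p. 221)] [cite: Washington1997, §13.2] -/
theorem one_le_lengthAt_coinvariants_iwasawaH1_of_admissibleZetaClassExists
    (hAdm : Summit.BirchSwinnertonDyer.BirchSwinnertonDyer.Theses.DerivedKatoValuationDoor.AdmissibleZetaClassExists)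
    (hdoor : 5 ≤ p ∧ IsOrdinaryAt W p ∧ W.HasSurjectiveModNGaloisRep p)
    {K : ZpExtension ℚ p} (hK : K.IsCyclotomic) {γ : absoluteGaloisGroup ℚ} (hγ : K.IsTopGenerator γ)
    (I : IwasawaH1Data W p K γ) :
    1 ≤ Module.lengthAt (IwasawaAlgebra p) (coinvariants p I.H) (primeT p) := by
  haveI : Module.Finite (IwasawaAlgebra p) I.H := IwasawaH1Data.module_finite_of_isCyclotomic hK hγ I
  haveI : Module.IsTorsionFree (IwasawaAlgebra p) I.H := I.isTorsionFree hγ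
  haveI := nontrivial_iwasawaH1_of_admissibleZetaClassExists W p hAdm hdoor hK hγ I
  exact one_le_lengthAt_coinvariants_of_isTorsionFree p

end FromAdmissible

/-- **F2 restricted to door primes, in the binder order of the named fact `Kato2004.one_le_rank_iwasawaH1`,
from the route item `AdmissibleZetaClassExists`**: for every globally minimal elliptic `W/ℚ`, every DOOR
PRIME `p`, every cyclotomic `κ` with topological generator `γ` and every pin `I`, `1 ≤ rank_Λ I.H`. (The
named fact itself has no door and no minimality hypothesis and is NOT proved here.) CONDITIONAL on the
route item only. [cite: Kato2004Asterisque, §12.2 (12.2.2) (p. 220)] -/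
theorem one_le_rank_iwasawaH1_at_door_of_admissibleZetaClassExists
    (hAdm : Summit.BirchSwinnertonDyer.BirchSwinnertonDyer.Theses.DerivedKatoValuationDoor.AdmissibleZetaClassExists) :
    ∀ (W : WeierstrassCurve ℚ) [W.IsElliptic] [W.IsGloballyMinimal] (p : ℕ) [Fact p.Prime]
      [ContinuousSMul ℤ_[p] (W.tateModule p)],
      (5 ≤ p ∧ IsOrdinaryAt W p ∧ W.HasSurjectiveModNGaloisRep p) →
      ∀ (κ : ZpExtension ℚ p) (γ : absoluteGaloisGroup ℚ), κ.IsCyclotomic → κ.IsTopGenerator γ →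
        ∀ I : IwasawaH1Data W p κ γ, 1 ≤ Module.rank (IwasawaAlgebra p) I.H :=
  fun W _ _ p _ _ hdoor _ _ hκ hγ I ↦
    one_le_rank_iwasawaH1_of_admissibleZetaClassExists W p hAdm hdoor hκ hγ I

/-! ## §3 The same non-triviality from any §17.13 package (`Kato2004.DivisibilityInputs`) -/

section FromPackage

variable {W : WeierstrassCurve ℚ} [W.IsElliptic] [W.IsGloballyMinimal] {p : ℕ} [Fact p.Prime]
  [ContinuousSMul ℤ_[p] (W.tateModule p)] {N : ℕ} [NeZero N] {f : CuspForm (Gamma0 N) 2}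
  {κ : ZpExtension ℚ p} {γ : absoluteGaloisGroup ℚ}

/-- **A §17.13 package makes `𝐇¹_Γ(T_pW)` non-zero**: the package's zeta module `K.Z ≤ 𝐇¹` contains a
class `z` with `col (loc z) = G`, `ι G = p^n · L_p(E,T)` (fields `pow_mem`, `ιG_eq`: Kato Thm. 16.6 (2) with
12.5 (1), 12.6), and `L_p(E,T) ≠ 0` at a good ordinary prime for a newform of `W` (Rohrlich; tree theorem
`padicLFunction_unitRoot_ne_zero`), so `G ≠ 0` and `z ≠ 0`.
[cite: Kato2004Asterisque, Thm. 16.6 (p. 271), Thm. 12.6 (p. 222), §17.13 (p. 279)]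
[cite: RohrlichInventiones1984, Theorem (p. 409)] -/
theorem nontrivial_iwasawaH1_of_divisibilityInputs {I : IwasawaH1Data W p κ γ} {D : W.SelmerDualData κ γ}
    (K : DivisibilityInputs W p f κ γ I D) (hord : IsOrdinaryAt W p) (hf : IsNewformOf W f) :
    Nontrivial I.H := by
  -- `G ≠ 0` since `ι G = C(p^n) · L_p` with both factors non-zero in the domain `ℚ_p⟦T⟧`
  have hG : K.G ≠ 0 := by
    intro h0
    have e := K.ιG_eq
    rw [h0, map_zero] at e
    have hC : PowerSeries.C ((p : ℚ_[p]) ^ K.n) ≠ 0 :=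
      (map_ne_zero_iff _ PowerSeries.C_injective).mpr
        (pow_ne_zero _ (Nat.cast_ne_zero.mpr (Fact.out : p.Prime).ne_zero))
    exact mul_ne_zero hC (padicLFunction_unitRoot_ne_zero hord hf) e.symm
  -- a class of `Z ≤ 𝐇¹` mapping to `G`
  obtain ⟨z, -, hzG⟩ := Submodule.mem_map.mp K.pow_mem
  refine nontrivial_of_ne z 0 fun h0 ↦ hG ?_
  rw [← hzG, h0, map_zero]

/-- **`𝐇¹_Γ(T_pW) ≠ 0` for EVERY cyclotomic pin from the named construction fact
`Kato2004.exists_divisibilityInputs`** (the §17.13 package exists over the normalised cyclotomic pair; odd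
good ordinary `p`, a newform `f` of `W`): instantiate the package on the pin transported to the normalised
pair `(κ₀, γ₀)` (`IwasawaH1Data.changeData`, same underlying group) with the constructed dual Selmer datum
`W.selmerDualData κ₀ hγ₀`, and read `nontrivial_iwasawaH1_of_divisibilityInputs`. CONDITIONAL on the named
fact (no `_holds`) and on a newform of `W`. [cite: Kato2004Asterisque, §17.13 (pp. 279–280), Thm. 12.6 (p. 222)]
[cite: Washington1997, §13.2] -/
theorem nontrivial_iwasawaH1_of_exists_divisibilityInputs (h17 : exists_divisibilityInputs) (hp : p ≠ 2)
    (hord : IsOrdinaryAt W p) (hf : IsNewformOf W f) (hκ : κ.IsCyclotomic) (hγ : κ.IsTopGenerator γ)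
    (I : IwasawaH1Data W p κ γ) : Nontrivial I.H := by
  obtain ⟨κ₀, hκ₀, γ₀, hγ₀, hγ₀'⟩ := exists_isCyclotomic_isTopGenerator_isCyclotomicVariable_holds p
  obtain ⟨c, rfl⟩ := ZpExtension.IsCyclotomic.exists_eq_unitTwist_holds (κ := κ₀) hκ₀ hκ
  obtain ⟨K⟩ := h17 W p f κ₀ γ₀ hp hord hκ₀ hγ₀ hγ₀' hf (I.changeData κ₀ c hγ hγ₀)
    (W.selmerDualData κ₀ hγ₀)
  exact (nontrivial_iwasawaH1_of_divisibilityInputs K hord hf : Nontrivial (I.changeData κ₀ c hγ hγ₀).H)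

end FromPackage

/-! ## §4 At an odd prime with `ρ̄_{E,p}` onto (every door prime), modulo ONLY Kato's construction fact
`exists_eulerSystem_expStar_values` and a newform of `W` (revision 2) -/

section FromConstruction

variable (W : WeierstrassCurve ℚ) [W.IsElliptic] (p : ℕ) [Fact p.Prime]
  [ContinuousSMul ℤ_[p] (W.tateModule p)]

/-- **`𝐇¹_Γ(T_pW) ≠ 0` for every cyclotomic pin at an odd prime with `ρ̄_{E,p}` onto, in EVERY analytic
rank, modulo Kato's construction fact alone** (and a newform `f` of `W`): the Λ-adic lift of a guarded Kato
zeta family is non-zero by Rohrlich — DISCHARGED here for every `p` by the tree theorem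
`PSRohrlichAtLevel.rohrlich_primePow_of_isNewformOf` — read at a high layer
(`Kato2004.nontrivial_iwasawaH1_of_expStar_values_of_rohrlich`, Kato Thm. 12.5 (1)); `W[p]` is irreducible
because `ρ̄` is onto (`hasIrreducibleModPGaloisRep_of_hasSurjectiveModNGaloisRep`); the `ℤ_p`-structure facts
of `T_pW` are tree theorems. CONDITIONAL on `exists_eulerSystem_expStar_values` (named fact, no `_holds`).
[cite: Kato2004Asterisque, Thm. 12.5 (1) and proof (pp. 221–222), Ex. 13.3 (p. 225)]
[cite: RohrlichInventiones1984, Theorem (p. 409)] -/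
theorem nontrivial_iwasawaH1_of_expStar_values_of_surjective (hES : exists_eulerSystem_expStar_values)
    (hp : p ≠ 2) (hsurj : W.HasSurjectiveModNGaloisRep p) {N : ℕ} [NeZero N]
    {f : CuspForm (Gamma0 N) 2} (hf : IsNewformOf W f) {K : ZpExtension ℚ p} (hK : K.IsCyclotomic)
    {γ : absoluteGaloisGroup ℚ} (I : IwasawaH1Data W p K γ) : Nontrivial I.H := by
  haveI : Module.Free ℤ_[p] (W.tateModule p) := W.module_free_tateModule_holds p
  haveI : Module.Finite ℤ_[p] (W.tateModule p) := W.module_finite_tateModule_holds p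
  haveI : NeZero (p : ℚ) := ⟨by exact_mod_cast (Fact.out : p.Prime).ne_zero⟩
  exact nontrivial_iwasawaH1_of_expStar_values_of_rohrlich W p I hK hES hp
    (hasIrreducibleModPGaloisRep_of_hasSurjectiveModNGaloisRep W p hsurj) f hf
    (PSRohrlichAtLevel.rohrlich_primePow_of_isNewformOf hf)

/-- **F2 at a door prime modulo Kato's construction fact alone**: `1 ≤ rank_Λ 𝐇¹_Γ(T_pW)` for every
cyclotomic pin at a door prime (indeed at every odd `p` with `ρ̄_{E,p}` onto), granted
`exists_eulerSystem_expStar_values` and a newform of `W` — `𝐇¹` is torsion free (`IwasawaH1Data.isTorsionFree`).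
[cite: Kato2004Asterisque, §12.2 (12.2.2) (p. 220), Thm. 12.4 (2) (p. 221), Thm. 12.5 (1) (pp. 221–222)] -/
theorem one_le_rank_iwasawaH1_of_expStar_values_of_door [W.IsGloballyMinimal]
    (hES : exists_eulerSystem_expStar_values)
    (hdoor : 5 ≤ p ∧ IsOrdinaryAt W p ∧ W.HasSurjectiveModNGaloisRep p) {N : ℕ} [NeZero N]
    {f : CuspForm (Gamma0 N) 2} (hf : IsNewformOf W f) {K : ZpExtension ℚ p} (hK : K.IsCyclotomic)
    {γ : absoluteGaloisGroup ℚ} (hγ : K.IsTopGenerator γ) (I : IwasawaH1Data W p K γ) :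
    1 ≤ Module.rank (IwasawaAlgebra p) I.H := by
  have hp : p ≠ 2 := by have := hdoor.1; omega
  haveI := nontrivial_iwasawaH1_of_expStar_values_of_surjective W p hES hp hdoor.2.2 hf hK I
  exact one_le_rank_iwasawaH1_of_nontrivial hγ I

/-- **The consumer shape of line `descent`, modulo Kato's construction fact alone**: at a door prime,
`1 ≤ ℓ_T(𝐇¹/T𝐇¹)` for every cyclotomic pin, granted `exists_eulerSystem_expStar_values` and a newform of `W`
(`𝐇¹` finitely generated, torsion free and — above — non-zero; `one_le_lengthAt_coinvariants_of_isTorsionFree`).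
An alternative to §2 for the LEAD: F2 ↦ {Kato's construction fact, modularity} instead of the route item 23029.
[cite: Kato2004Asterisque, §12.2 (12.2.1)–(12.2.2) (p. 220), Thm. 12.4 (2) (p. 221), Thm. 12.5 (1) (pp. 221–222)] -/
theorem one_le_lengthAt_coinvariants_iwasawaH1_of_expStar_values_of_door [W.IsGloballyMinimal]
    (hES : exists_eulerSystem_expStar_values)
    (hdoor : 5 ≤ p ∧ IsOrdinaryAt W p ∧ W.HasSurjectiveModNGaloisRep p) {N : ℕ} [NeZero N]
    {f : CuspForm (Gamma0 N) 2} (hf : IsNewformOf W f) {K : ZpExtension ℚ p} (hK : K.IsCyclotomic)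
    {γ : absoluteGaloisGroup ℚ} (hγ : K.IsTopGenerator γ) (I : IwasawaH1Data W p K γ) :
    1 ≤ Module.lengthAt (IwasawaAlgebra p) (coinvariants p I.H) (primeT p) := by
  have hp : p ≠ 2 := by have := hdoor.1; omega
  haveI : Module.Finite (IwasawaAlgebra p) I.H := IwasawaH1Data.module_finite_of_isCyclotomic hK hγ I
  haveI : Module.IsTorsionFree (IwasawaAlgebra p) I.H := I.isTorsionFree hγ
  haveI := nontrivial_iwasawaH1_of_expStar_values_of_surjective W p hES hp hdoor.2.2 hf hK I
  exact one_le_lengthAt_coinvariants_of_isTorsionFree p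

end FromConstruction

end Summit.BirchSwinnertonDyer.BirchSwinnertonDyer.Theorems.DerivedKatoValuationDoor

end
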